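import Literature.Geometry.Lorentzian.CarterHorizonZone
import Literature.Analysis.ODE.TameZoneTransport
import HarnessLib

/-!
# The near zone `r ≤ 7M` of Carter's equation: transport of the `η`-energy across tame zones
(namespace `Literature.Geometry.Lorentzian.Kerr`.)

Companion of `CarterHorizonZone.lean` / `CarterFarEnvelope.lean`. Between the horizon zone
(`ρ − r₊ ≤ σ²M³/(416Λ)`, where the coefficient `φ = ω² − V∘ρ` of Carter's equation
`u″ + φu = 0` is comparable to `σ²`) and the far zone (`ρ ≥ 7M`, where `V` decreases), the
coefficient may become small or change sign (turning points, shallow barriers). On any sub-zone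
`[Z₁, Z₂]` of `r ≤ 7M` on which `φ ≥ −η²` the `η`-energy `η²‖u‖² + ‖u′‖²` is transported with the
factor `(Φ/η²)^16 · exp(2η(Z₂ − Z₁))` — at most eight monotone pieces of `φ`
(`IsTortoiseRadius.exists_monotone_partition`) fed into the generic TAME-ZONE TRANSPORT lemma
`Literature.Analysis.ODE.tameZone_transport` (Sonin blocks + transition collars):

* `coeff_le_of_admissible` — `φ ≤ ω² + 6Λ/M²` everywhere (`|V| ≤ 3Λ/r² + 3M/r³`, `Λ ≥ 1`);
* `carter_tameZone_transport` — the transport inequality on `[Z₁, Z₂]`, `φ ≥ −η²` there;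
* `IsTortoiseRadius.tameZone_length_le` — `Z₂ − Z₁ ≤ (25/κ)·log(2496Λ/(σ²M²))` when `Z₁` lies to the
  right of the horizon zone's edge `ρ = r₊ + σ²M³/(416Λ)` and `ρ Z₂ ≤ 7M`.

## References
* M. Dafermos, I. Rodnianski, Y. Shlapentokh-Rothman, arXiv:1402.7034, §§6.3, 8 (frequency-localised
  multiplier estimates whose constants these elementary transport factors replace in the cone);
  key `DafermosRodnianskiShlapentokhrothman2014`.
* F. W. J. Olver, *Asymptotics and Special Functions* (1974), Ch. 6 (LG approximation); key `Olver1974`.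
-/

noncomputable section

open Filter Set
open scoped _root_.Topology

namespace Literature.Geometry.Lorentzian

namespace Kerr

/-- **Upper bound of Carter's coefficient**: `ω² − V(r) ≤ ω² + 6Λ/M²` on `r ≥ r₊` for an admissible
triple with `Λ ≥ 1` (`|V| ≤ 3Λ/r² + 3M/r³ ≤ 6Λ/M²`). [cite: DafermosRodnianskiShlapentokhrothman2014, §8.4] -/
theorem coeff_le_of_admissible {M a ω Λ : ℝ} {m : ℤ} (hM : 0 < M) (haM : |a| ≤ M)
    (hadm : IsAdmissibleTriple a ω m Λ) (hΛ : 1 ≤ Λ) {r : ℝ} (hr : rPlus M a ≤ r) :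
    ω ^ 2 - sepPotential M a ω m Λ r ≤ ω ^ 2 + 6 * Λ / M ^ 2 := by
  have hMr : M ≤ r := (M_le_rPlus M a).trans hr
  have hr0 : 0 < r := hM.trans_le hMr
  have hV := abs_sepPotential_le hM haM hadm hr
  have h1 : 3 * Λ / r ^ 2 ≤ 3 * Λ / M ^ 2 := by
    apply div_le_div_of_nonneg_left (by positivity) (by positivity)
    exact pow_le_pow_left₀ hM.le hMr 2
  have h2 : 3 * M / r ^ 3 ≤ 3 / M ^ 2 := by
    rw [div_le_div_iff₀ (by positivity) (by positivity)]
    have : M ^ 3 ≤ r ^ 3 := pow_le_pow_left₀ hM.le hMr 3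
    nlinarith
  have h3 : 3 * Λ / M ^ 2 + 3 / M ^ 2 ≤ 6 * Λ / M ^ 2 := by
    rw [← add_div]
    exact div_le_div_of_nonneg_right (by linarith) (by positivity)
  have : -(sepPotential M a ω m Λ r) ≤ 3 * Λ / r ^ 2 + 3 * M / r ^ 3 := by
    have := (abs_le.1 hV).1
    linarith
  linarith

/-- **Length of a tame zone**: if `r₊ + σ²M³/(416Λ) ≤ ρ Z₁`, `Z₁ ≤ Z₂`, `ρ Z₂ ≤ 7M` (`σ ≠ 0`, `Λ ≥ 1`,
`|a| < M`), then `Z₂ − Z₁ ≤ (25/κ)·log(2496Λ/(σ²M²))` (`IsTortoiseRadius.sub_le_mul_log_div` and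
`log((ρZ₂ − r₊)/(ρZ₁ − r₊)) ≤ log(6M·416Λ/(σ²M³))`). [cite: DafermosRodnianskiShlapentokhrothman2014, §2.1.2] -/
theorem IsTortoiseRadius.tameZone_length_le {M a : ℝ} {ρ : ℝ → ℝ} (hρ : IsTortoiseRadius M a ρ)
    (hMa : IsSubextremal M a) {σ Λ Z₁ Z₂ : ℝ} (hσ : σ ≠ 0) (hΛ : 1 ≤ Λ)
    (hZ₁ : rPlus M a + σ ^ 2 * M ^ 3 / (416 * Λ) ≤ ρ Z₁) (hZ : Z₁ ≤ Z₂) (hZ₂ : ρ Z₂ ≤ 7 * M) :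
    Z₂ - Z₁ ≤ 25 / surfaceGravity M a * Real.log (2496 * Λ / (σ ^ 2 * M ^ 2)) := by
  have hM : 0 < M := hMa.pos
  have hκ : 0 < surfaceGravity M a := hMa.surfaceGravity_pos
  have hlen := hρ.sub_le_mul_log_div hMa hZ hZ₂
  have hσ2 : 0 < σ ^ 2 := by positivity
  have hlow : 0 < σ ^ 2 * M ^ 3 / (416 * Λ) := by positivity
  have h1 : 0 < ρ Z₁ - rPlus M a := by linarith
  have h2 : ρ Z₂ - rPlus M a ≤ 6 * M := by linarith [M_le_rPlus M a]
  have h3 : ρ Z₁ - rPlus M a ≤ ρ Z₂ - rPlus M a := by linarith [(hρ.strictMono hMa).monotone hZ]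
  have h4 : 0 < ρ Z₂ - rPlus M a := h1.trans_le h3
  have hlog : Real.log (ρ Z₂ - rPlus M a) - Real.log (ρ Z₁ - rPlus M a) ≤
      Real.log (2496 * Λ / (σ ^ 2 * M ^ 2)) := by
    rw [← Real.log_div h4.ne' h1.ne']
    apply Real.log_le_log (div_pos h4 h1)
    rw [div_le_div_iff₀ h1 (by positivity)]
    calc (ρ Z₂ - rPlus M a) * (σ ^ 2 * M ^ 2) ≤ 6 * M * (σ ^ 2 * M ^ 2) := by gcongr
      _ = 2496 * Λ * (σ ^ 2 * M ^ 3 / (416 * Λ)) := by field_simp; ring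
      _ ≤ 2496 * Λ * (ρ Z₁ - rPlus M a) := by gcongr; linarith
  calc Z₂ - Z₁ ≤ 25 / surfaceGravity M a *
        (Real.log (ρ Z₂ - rPlus M a) - Real.log (ρ Z₁ - rPlus M a)) := hlen
    _ ≤ 25 / surfaceGravity M a * Real.log (2496 * Λ / (σ ^ 2 * M ^ 2)) := by gcongr

section TameZone

variable {M a ω Λ : ℝ} {m : ℤ} {ρ : ℝ → ℝ} {u u₁ : ℝ → ℂ}

/-- **Transport across a tame zone of Carter's coefficient.** For `Z₁ < Z₂` with
`−η² ≤ ω² − V(ρ s)` on `[Z₁, Z₂]`, `0 < η`, `η² ≤ Φ` and `ω² − V ∘ ρ ≤ Φ` there, every solution `u` of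
Carter's equation satisfies, for all `x, y ∈ [Z₁, Z₂]`,
`η²‖u y‖² + ‖u′ y‖² ≤ (Φ/η²)^16 · exp(2η(Z₂ − Z₁)) · (η²‖u x‖² + ‖u′ x‖²)`
(≤ 8 monotone pieces fed into `Literature.Analysis.ODE.tameZone_transport`; `(Φ/η²)^{2k} ≤ (Φ/η²)^{16}`).
[folklore] -/
theorem carter_tameZone_transport
    (hρ : IsTortoiseRadius M a ρ) (hMa : IsSubextremal M a) (hadm : IsAdmissibleTriple a ω m Λ)
    (hu : ∀ x, HasDerivAt u (u₁ x) x ∧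
      HasDerivAt u₁ (-(((ω ^ 2 - sepPotential M a ω m Λ (ρ x) : ℝ) : ℂ) * u x)) x)
    {Z₁ Z₂ η Φ : ℝ} (hZ : Z₁ < Z₂) (hη : 0 < η) (hηΦ : η ^ 2 ≤ Φ)
    (hzone : ∀ s ∈ Icc Z₁ Z₂, -η ^ 2 ≤ ω ^ 2 - sepPotential M a ω m Λ (ρ s) ∧
      ω ^ 2 - sepPotential M a ω m Λ (ρ s) ≤ Φ)
    {x y : ℝ} (hx : x ∈ Icc Z₁ Z₂) (hy : y ∈ Icc Z₁ Z₂) :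
    η ^ 2 * ‖u y‖ ^ 2 + ‖u₁ y‖ ^ 2 ≤
      (Φ / η ^ 2) ^ 16 * Real.exp (2 * η * (Z₂ - Z₁)) * (η ^ 2 * ‖u x‖ ^ 2 + ‖u₁ x‖ ^ 2) := by
  obtain ⟨k, t, hk, ht0, htk, hmono_t, hmono⟩ := hρ.exists_monotone_partition hMa hadm hZ
  set φ : ℝ → ℝ := fun s ↦ ω ^ 2 - sepPotential M a ω m Λ (ρ s) with hφ
  have key := Literature.Analysis.ODE.tameZone_transport (u := u) (u' := u₁) (φ := φ)
    (φ' := fun s ↦ -(deriv (sepPotential M a ω m Λ) (ρ s) * (delta M a (ρ s) / (ρ s ^ 2 + a ^ 2))))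
    (η := η) (Φ := Φ) t hmono_t (fun s _ ↦ ⟨(hu s).1, by simpa only [hφ] using (hu s).2⟩)
    (fun s _ ↦ hρ.hasDerivAt_omega_sq_sub_sepPotential hMa ω m Λ s) hmono hη hηΦ
    (fun s hs ↦ hzone s (by rw [ht0, htk] at hs; exact hs)) (by rw [ht0, htk]; exact hx)
    (by rw [ht0, htk]; exact hy)
  rw [ht0, htk] at key
  refine key.trans (mul_le_mul_of_nonneg_right (mul_le_mul_of_nonneg_right ?_ (Real.exp_pos _).le)
    (by positivity))
  have h1 : 1 ≤ Φ / η ^ 2 := by rw [le_div_iff₀ (by positivity)]; linarith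
  exact pow_le_pow_right₀ h1 (by omega)

end TameZone

end Kerr

end Literature.Geometry.Lorentzian

end
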